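import Mathlib
import Summits.Ventures.PercRepro.TriangleCapTopSubBands

/-!
# PercRepro — THE SUB-BAND `u = 1` FROM ABOVE: `j ≤ t + ℓ − 3` (p3, gen 52; part 255)

At the band value `2 j` of a vertex `w` with `t` off-edges, when a non-neighbour `x` of `w` carries `t − 1` of them
(the sub-band `u = 1`: a `(t − 1)`-star at `x` plus ONE edge `e = {p, q}` off `x`), `j ≤ t + ℓ − 3`, `ℓ` the number
of non-neighbours of `w`.  In a triangle-free graph `attach = t − |inside|` (`inside` = the off-edges missing
`N(w)`, `attach_add_card_inside`), and `offAdjPairs ≥ (t − 1)(t − 2) + 2 [e meets N_F(x)]` (an end of `e` adjacent to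
`x` has off-degree `2`), so `j ≤ t − 2 + |inside| + [e misses N_F(x)]`; and THE COUNT `|inside| + [e misses N_F(x)]
≤ ℓ − 1` (`count_inside_one`): the inside star edges inject by their second end into the non-neighbours other than
`x` adjacent to `x`, while the ends of `e` among the non-neighbours NOT adjacent to `x` are disjoint from that image —
two of them when `e` is inside and misses `N_F(x)`, one when `e` is inside (triangle-freeness) or when `e` misses
`N_F(x)` (the end of `e` off `N(w)`).  Axioms: standard.
-/

namespace PercRepro

namespace TriangleCap

namespace C047

open Finset

variable {V : Type*} [Fintype V] [DecidableEq V]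

omit [Fintype V] in
/-- Triangle-freeness: two neighbours of a vertex are not adjacent. -/
theorem not_adj_of_adj_adj (H : SimpleGraph V) (hfree : H.CliqueFree 3) {a b c : V} (hab : H.Adj a b)
    (hac : H.Adj a c) : ¬ H.Adj b c :=
  fun hbc => hfree {a, b, c} (SimpleGraph.is3Clique_triple_iff.mpr ⟨hab, hac, hbc⟩)

/-- **`attach = |F| − |inside|` in a triangle-free graph:** every off-edge meets `N(w)` at most once. -/
theorem attach_add_card_inside (H : SimpleGraph V) [DecidableRel H.Adj] (hfree : H.CliqueFree 3) (w : V) :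
    attach H w + (insideEdges H w).card = (offEdges H w).card := by
  have h1 := card_offEdges_le_attach_add_inside H w
  have h2 : attach H w + (insideEdges H w).card ≤ (offEdges H w).card := by
    rw [attach_eq_sum_card]
    have hsplit := card_filter_add_card_filter_not (s := offEdges H w)
      (fun e => (univ.filter (fun v => H.Adj w v ∧ v ∈ e)).card = 0)
    have hle : ∑ e ∈ offEdges H w, (univ.filter (fun v => H.Adj w v ∧ v ∈ e)).card ≤
        ((offEdges H w).filter (fun e => ¬ (univ.filter (fun v => H.Adj w v ∧ v ∈ e)).card = 0)).card := by
      rw [← sum_filter_add_sum_filter_not (offEdges H w)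
        (fun e => (univ.filter (fun v => H.Adj w v ∧ v ∈ e)).card = 0)]
      rw [sum_eq_zero (fun e he => (mem_filter.mp he).2), zero_add, card_eq_sum_ones]
      apply sum_le_sum
      intro e he
      exact card_adj_mem_le_one H hfree w e (mem_edgeFinset_of_mem_offEdges H w (mem_filter.mp he).1)
    unfold insideEdges
    omega
  omega

/-- `offAdjPairs` is at least the contribution of two distinct vertices `x, q ≠ w`. -/
theorem offAdjPairs_ge_pair (H : SimpleGraph V) [DecidableRel H.Adj] (w x q : V) (hxw : x ≠ w) (hqw : q ≠ w)
    (hxq : x ≠ q) :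
    offDeg H w x * (offDeg H w x - 1) + offDeg H w q * (offDeg H w q - 1) ≤ offAdjPairs H w := by
  rw [← sum_erase_offDeg_mul_pred]
  have hsub : ({x, q} : Finset V) ⊆ univ.erase w := by
    intro v hv
    rw [mem_insert, mem_singleton] at hv
    rw [mem_erase]
    rcases hv with rfl | rfl
    · exact ⟨hxw, mem_univ _⟩
    · exact ⟨hqw, mem_univ _⟩
  have := sum_le_sum_of_subset (f := fun v => offDeg H w v * (offDeg H w v - 1)) hsub
  rw [sum_pair hxq] at this
  exact this

/-- Every off-degree `≤ 2` ⇒ `offAdjPairs ≤ 2 |F|`. -/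
theorem offAdjPairs_le_of_offDeg_le_two (H : SimpleGraph V) [DecidableRel H.Adj] (w : V)
    (h : ∀ v, offDeg H w v ≤ 2) : offAdjPairs H w ≤ 2 * (offEdges H w).card := by
  rw [← sum_erase_offDeg_mul_pred, ← sum_erase_offDeg]
  apply sum_le_sum
  intro v _
  have := h v
  have hc : offDeg H w v = 0 ∨ offDeg H w v = 1 ∨ offDeg H w v = 2 := by omega
  rcases hc with hc | hc | hc <;> simp [hc]

/-- An edge `s(a, b)` with `a, b ≠ w` is an off-edge iff `a ∼ b`. -/
theorem mem_offEdges_iff_adj (H : SimpleGraph V) [DecidableRel H.Adj] (w a b : V) (haw : a ≠ w) (hbw : b ≠ w) :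
    s(a, b) ∈ offEdges H w ↔ H.Adj a b := by
  rw [mem_offEdges, SimpleGraph.mem_edgeFinset, SimpleGraph.mem_edgeSet, Sym2.mem_iff]
  constructor
  · exact fun h => h.1
  · intro h
    refine ⟨h, ?_⟩
    rintro (rfl | rfl)
    · exact haw rfl
    · exact hbw rfl

/-- An end of the extra edge adjacent to `x` has off-degree at least `2`. -/
theorem two_le_offDeg_of_adj (H : SimpleGraph V) [DecidableRel H.Adj] (w x p q : V) (hxw : x ≠ w) (hpw : p ≠ w)
    (hqw : q ≠ w) (hxq : x ≠ q) (hpq : H.Adj p q) (hxp : H.Adj x p) : 2 ≤ offDeg H w p := by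
  unfold offDeg
  rw [Nat.succ_le_iff, one_lt_card]
  refine ⟨s(x, p), ?_, s(p, q), ?_, ?_⟩
  · rw [mem_filter]
    exact ⟨(mem_offEdges_iff_adj H w x p hxw hpw).mpr hxp, Sym2.mem_mk_right x p⟩
  · rw [mem_filter]
    exact ⟨(mem_offEdges_iff_adj H w p q hpw hqw).mpr hpq, Sym2.mem_mk_left p q⟩
  · intro h
    rw [Sym2.eq_iff] at h
    rcases h with ⟨h1, h2⟩ | ⟨h1, h2⟩
    · exact hxq (h1.trans h2)
    · exact hxq h1

/-- **THE COUNT OF THE SUB-BAND `u = 1`:** with all off-edges but `s(p, q)` at the non-neighbour `x`,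
`|inside| + [s(p, q) misses N_F(x)] + 1 ≤ |nonNbrs|`. -/
theorem count_inside_one (H : SimpleGraph V) [DecidableRel H.Adj] (hfree : H.CliqueFree 3) (w x p q : V)
    (hxw : ¬ H.Adj w x) (hxw' : x ≠ w) (hpq : H.Adj p q) (hpw : p ≠ w) (hqw : q ≠ w) (hxp : x ≠ p) (hxq : x ≠ q)
    (hall : ∀ e ∈ offEdges H w, e ≠ s(p, q) → x ∈ e) :
    (insideEdges H w).card + (if ¬ H.Adj x p ∧ ¬ H.Adj x q then 1 else 0) + 1 ≤ (nonNbrs H w).card := by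
  have hx : x ∈ nonNbrs H w := (mem_nonNbrs H w x).mpr ⟨hxw', hxw⟩
  -- the inside star edges and their second ends
  set S := (insideEdges H w).filter (fun e => x ∈ e) with hS
  have himg : (S.image (otherEnd x)).card = S.card := by
    rw [card_image_of_injOn]
    intro e he e' he' heq
    rw [mem_coe, hS, mem_filter] at he he'
    unfold otherEnd at heq
    rw [dif_pos he.2, dif_pos he'.2] at heq
    rw [← Sym2.other_spec he.2, ← Sym2.other_spec he'.2, heq]
  have himg_sub : ∀ v ∈ S.image (otherEnd x), v ∈ (nonNbrs H w).erase x ∧ H.Adj x v := by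
    intro v hv
    rw [mem_image] at hv
    obtain ⟨e, he, rfl⟩ := hv
    rw [hS, mem_filter] at he
    have he' := (mem_insideEdges H w e).mp he.1
    have hne := mem_edgeFinset_of_mem_offEdges H w he'.1
    have hdiag : ¬ e.IsDiag := H.not_isDiag_of_mem_edgeSet (SimpleGraph.mem_edgeFinset.mp hne)
    unfold otherEnd
    rw [dif_pos he.2, mem_erase, mem_nonNbrs]
    refine ⟨⟨Sym2.other_ne hdiag he.2, ?_, he'.2 _ (Sym2.other_mem he.2)⟩, ?_⟩
    · intro hw
      exact notMem_of_mem_offEdges H w he'.1 (hw ▸ Sym2.other_mem he.2)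
    · have : s(x, Sym2.Mem.other he.2) ∈ H.edgeFinset := by rw [Sym2.other_spec he.2]; exact hne
      exact (SimpleGraph.mem_edgeSet H).mp (SimpleGraph.mem_edgeFinset.mp this)
  -- the ends of `s(p, q)` among the non-neighbours not adjacent to `x`
  set P := ((nonNbrs H w).erase x).filter (fun v => v ∈ s(p, q) ∧ ¬ H.Adj x v) with hP
  have hdisj : Disjoint (S.image (otherEnd x)) P := by
    rw [disjoint_left]
    intro v hv hvP
    rw [hP, mem_filter] at hvP
    exact hvP.2.2 (himg_sub v hv).2
  have hunion : (S.image (otherEnd x)).card + P.card ≤ ((nonNbrs H w).erase x).card := by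
    rw [← card_union_of_disjoint hdisj]
    apply card_le_card
    intro v hv
    rw [mem_union] at hv
    rcases hv with hv | hv
    · exact (himg_sub v hv).1
    · exact (mem_filter.mp hv).1
  rw [card_erase_of_mem hx] at hunion
  have hpos : 0 < (nonNbrs H w).card := card_pos.mpr ⟨x, hx⟩
  -- `|inside| ≤ |S| + [s(p, q) ∈ inside]`
  have hins : (insideEdges H w).card ≤ S.card + (if s(p, q) ∈ insideEdges H w then 1 else 0) := by
    have hsplit := card_filter_add_card_filter_not (s := insideEdges H w) (fun e => x ∈ e)
    rw [← hS] at hsplit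
    have hrest : (insideEdges H w).filter (fun e => ¬ x ∈ e) ⊆ {s(p, q)} := by
      intro e he
      rw [mem_filter] at he
      rw [mem_singleton]
      by_contra hne
      exact he.2 (hall e ((mem_insideEdges H w e).mp he.1).1 hne)
    have := card_le_card hrest
    rw [card_singleton] at this
    split_ifs with hin
    · omega
    · have hempty : (insideEdges H w).filter (fun e => ¬ x ∈ e) = ∅ := by
        rw [eq_empty_iff_forall_notMem]
        intro e he
        have := hrest he
        rw [mem_singleton] at this
        rw [this] at he
        exact hin (mem_filter.mp he).1
      rw [hempty, card_empty] at hsplit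
      omega
  -- `[s(p, q) ∈ inside] + [misses] ≤ |P|`
  have hP_ge : (if s(p, q) ∈ insideEdges H w then 1 else 0) +
      (if ¬ H.Adj x p ∧ ¬ H.Adj x q then 1 else 0) ≤ P.card := by
    have hpq' : s(p, q) ∈ offEdges H w := (mem_offEdges_iff_adj H w p q hpw hqw).mpr hpq
    have hmemP : ∀ v, v ∈ s(p, q) → ¬ H.Adj w v → ¬ H.Adj x v → v ∈ P := by
      intro v hv hwv hxv
      rw [hP, mem_filter, mem_erase, mem_nonNbrs]
      refine ⟨⟨?_, ?_, hwv⟩, hv, hxv⟩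
      · intro hvx
        rw [Sym2.mem_iff] at hv
        rcases hv with rfl | rfl
        · exact hxp hvx.symm
        · exact hxq hvx.symm
      · intro hvw
        rw [Sym2.mem_iff] at hv
        rcases hv with rfl | rfl
        · exact hpw hvw
        · exact hqw hvw
    have hpne : p ≠ q := hpq.ne
    split_ifs with hin hmiss hmiss
    · -- inside: both ends are non-neighbours; at most one is adjacent to `x`
      have hin' := (mem_insideEdges H w _).mp hin
      have hwp : ¬ H.Adj w p := hin'.2 p (Sym2.mem_mk_left p q)
      have hwq : ¬ H.Adj w q := hin'.2 q (Sym2.mem_mk_right p q)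
      have : 1 < P.card := one_lt_card.mpr ⟨p, hmemP p (Sym2.mem_mk_left p q) hwp hmiss.1, q,
        hmemP q (Sym2.mem_mk_right p q) hwq hmiss.2, hpne⟩
      omega
    · have hin' := (mem_insideEdges H w _).mp hin
      have hwp : ¬ H.Adj w p := hin'.2 p (Sym2.mem_mk_left p q)
      have hwq : ¬ H.Adj w q := hin'.2 q (Sym2.mem_mk_right p q)
      by_cases hxp' : H.Adj x p
      · have hxq' : ¬ H.Adj x q := not_adj_of_adj_adj H hfree hxp'.symm hpq
        exact card_pos.mpr ⟨q, hmemP q (Sym2.mem_mk_right p q) hwq hxq'⟩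
      · exact card_pos.mpr ⟨p, hmemP p (Sym2.mem_mk_left p q) hwp hxp'⟩
    · -- not inside: an end is a neighbour of `w`, the other is not
      have hnot : ∃ v, v ∈ s(p, q) ∧ H.Adj w v := by
        by_contra hcon
        apply hin
        rw [mem_insideEdges]
        refine ⟨hpq', fun v hv hwv => hcon ⟨v, hv, hwv⟩⟩
      obtain ⟨v, hv, hwv⟩ := hnot
      rw [Sym2.mem_iff] at hv
      rcases hv with rfl | rfl
      · have hwq : ¬ H.Adj w q := not_adj_of_adj_adj H hfree hwv.symm hpq
        exact card_pos.mpr ⟨q, hmemP q (Sym2.mem_mk_right v q) hwq hmiss.2⟩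
      · have hwp : ¬ H.Adj w p := not_adj_of_adj_adj H hfree hwv.symm hpq.symm
        exact card_pos.mpr ⟨p, hmemP p (Sym2.mem_mk_left p v) hwp hmiss.1⟩
    · exact Nat.zero_le _
  omega

/-- **THE SUB-BAND `u = 1` FROM ABOVE:** at the band value `2 j`, a non-neighbour `x` of `w` with
`offDeg H w x + 1 = t` (`2 ≤ t`) forces `j + 3 ≤ t + |nonNbrs|`. -/
theorem band_le_of_offDeg_pred (H : SimpleGraph V) [DecidableRel H.Adj] (hfree : H.CliqueFree 3) (s t j : ℕ)
    (hs : H.edgeFinset.card = s) (w : V) (hw : 1 ≤ deg H w) (ht : (offEdges H w).card = t)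
    (hj : ∑ v, deg H v * deg H v + 2 * (t * (s - t - 1)) + 2 * j = s * (s + 1)) (x : V)
    (hx : offDeg H w x + 1 = t) (hxw : ¬ H.Adj w x) (ht2 : 2 ≤ t) :
    j + 3 ≤ t + (nonNbrs H w).card := by
  have hxw' : x ≠ w := by
    intro h
    rw [h, offDeg_self] at hx
    omega
  -- the extra edge
  have hsplit := card_filter_add_card_filter_not (s := offEdges H w) (fun e => x ∈ e)
  have hone : ((offEdges H w).filter (fun e => ¬ x ∈ e)).card = 1 := by
    unfold offDeg at hx
    omega
  obtain ⟨e₀, he₀⟩ := card_eq_one.mp hone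
  have he₀F : e₀ ∈ offEdges H w := by
    have : e₀ ∈ (offEdges H w).filter (fun e => ¬ x ∈ e) := by rw [he₀]; exact mem_singleton_self _
    exact (mem_filter.mp this).1
  have hxe₀ : x ∉ e₀ := by
    have : e₀ ∈ (offEdges H w).filter (fun e => ¬ x ∈ e) := by rw [he₀]; exact mem_singleton_self _
    exact (mem_filter.mp this).2
  have hall : ∀ e ∈ offEdges H w, e ≠ e₀ → x ∈ e := by
    intro e he hne
    by_contra hxe
    have : e ∈ (offEdges H w).filter (fun e => ¬ x ∈ e) := mem_filter.mpr ⟨he, hxe⟩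
    rw [he₀, mem_singleton] at this
    exact hne this
  have hval := (layer_value_iff H s t j hs w hw ht).mp hj
  have hatt := attach_add_card_inside H hfree w
  rw [ht] at hatt
  have hPx : offDeg H w x * (offDeg H w x - 1) = (t - 1) * (t - 2) := by
    have e1 : offDeg H w x = t - 1 := by omega
    rw [e1]
    have : t - 1 - 1 = t - 2 := by omega
    rw [this]
  have e3 : t * (t + 1) = (t - 1) * (t - 2) + 4 * t - 2 := by
    obtain ⟨t', rfl⟩ : ∃ t', t = t' + 2 := ⟨t - 2, by omega⟩
    have h1 : t' + 2 - 1 = t' + 1 := by omega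
    have h2 : t' + 2 - 2 = t' := by omega
    rw [h1, h2]
    have : (t' + 1) * t' + 4 * (t' + 2) = (t' + 2) * (t' + 2 + 1) + 2 := by ring
    omega
  revert he₀F hxe₀ hall
  induction e₀ using Sym2.ind with
  | _ p q =>
  intro he₀F hxe₀ hall
  have hpw : p ≠ w := fun h => notMem_of_mem_offEdges H w he₀F (h ▸ Sym2.mem_mk_left p q)
  have hqw : q ≠ w := fun h => notMem_of_mem_offEdges H w he₀F (h ▸ Sym2.mem_mk_right p q)
  have hpq : H.Adj p q := (mem_offEdges_iff_adj H w p q hpw hqw).mp he₀F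
  have hxp : x ≠ p := fun h => hxe₀ (h ▸ Sym2.mem_mk_left p q)
  have hxq : x ≠ q := fun h => hxe₀ (h ▸ Sym2.mem_mk_right p q)
  have hcount := count_inside_one H hfree w x p q hxw hxw' hpq hpw hqw hxp hxq hall
  by_cases hmiss : ¬ H.Adj x p ∧ ¬ H.Adj x q
  · rw [if_pos hmiss] at hcount
    have hP : (t - 1) * (t - 2) ≤ offAdjPairs H w := by
      have := offAdjPairs_ge_pair H w x q hxw' hqw hxq
      rw [hPx] at this
      omega
    omega
  · rw [if_neg hmiss] at hcount
    have hP : (t - 1) * (t - 2) + 2 ≤ offAdjPairs H w := by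
      by_cases hxp' : H.Adj x p
      · have h2 := two_le_offDeg_of_adj H w x p q hxw' hpw hqw hxq hpq hxp'
        have := offAdjPairs_ge_pair H w x p hxw' hpw hxp
        rw [hPx] at this
        have : 2 ≤ offDeg H w p * (offDeg H w p - 1) := by
          obtain ⟨d, hd⟩ : ∃ d, offDeg H w p = d + 2 := ⟨offDeg H w p - 2, by omega⟩
          rw [hd]
          have : d + 2 - 1 = d + 1 := by omega
          rw [this]
          nlinarith
        omega
      · have hxq' : H.Adj x q := by
          by_contra hxq'
          exact hmiss ⟨hxp', hxq'⟩
        have h2 := two_le_offDeg_of_adj H w x q p hxw' hqw hpw hxp hpq.symm hxq'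
        have := offAdjPairs_ge_pair H w x q hxw' hqw hxq
        rw [hPx] at this
        have : 2 ≤ offDeg H w q * (offDeg H w q - 1) := by
          obtain ⟨d, hd⟩ : ∃ d, offDeg H w q = d + 2 := ⟨offDeg H w q - 2, by omega⟩
          rw [hd]
          have : d + 2 - 1 = d + 1 := by omega
          rw [this]
          nlinarith
        omega
    omega

end C047

end TriangleCap

end PercRepro
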